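import Mathlib.Analysis.Complex.IsIntegral
import Literature.NumberTheory.Transcendental.BakerLogarithmsConclusion

/-!
# `NormalFormPrinciple` (stmt-KontsevichZagierPeriods-3869), line `SketchIdeator1` — the mixed Baker
# endgame `eq_zero_of_alg_logs_angles_eq_zero` (arctangent layer; siege attempt k8:
# certificate / decide on the finite core)

Pure proof file (`--supports` the crux stmt-KontsevichZagierPeriods-3869), no definitions. It proves
the registered sub-goal

* `eq_zero_of_alg_logs_angles_eq_zero`: if `ε₁, …, ε_s > 0` are real algebraic numbers whose
  logarithms are `ℚ`-linearly independent, `θ₁, …, θ_{s'}` are `ℚ`-linearly independent real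
  numbers with every `e^{iθ_k}` algebraic, and
  `r + Σᵢ Cᵢ log εᵢ + Σ_k D_k θ_k = 0` with real ALGEBRAIC `r, Cᵢ, D_k`,
  then `r = 0`, every `Cᵢ = 0` and every `D_k = 0`

of the arctangent layer of the leaf `stub_boxRigidity` (values `r + Σ Cⱼ log aⱼ + Σ D_k θ_k` of
one-dimensional rational integral representations whose denominators have non-real algebraic
roots: `θ_k` are arguments of algebraic numbers, i.e. `iθ_k` is a determination of the logarithm of
the algebraic number `e^{iθ_k}` of modulus one).

Organisation of the proof ("certificate, then decide on the finite core"):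

1. `linearIndependent_rat_logs_angles` — the `ℚ`-relations separate: the `ℚ`-linear map
   `z ↦ (re z, im z) : ℂ → ℝ × ℝ` sends the mixed family `(log εᵢ)ᵢ, (iθ_k)_k` to
   `(log εᵢ, 0)ᵢ, (0, θ_k)_k`, which is `ℚ`-independent (`linearIndependent_inl_union_inr'`).
2. `linearIndependent_algebraicClosure_one_logs_angles` — the TRANSCENDENCE input enters exactly
   once: Baker's theorem (`Literature.NumberTheory.Transcendental.baker_holds`, Baker 1975,
   Thm. 2.1, proved in the tree) at the complex logarithms `lᵢ = log εᵢ` (`e^{lᵢ} = εᵢ`) and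
   `l_k = iθ_k` (`e^{l_k}` algebraic by hypothesis), indexed by `Fin s ⊕ Fin s'`. Its output is a
   CERTIFICATE: the finite family `1, (log εᵢ)ᵢ, (iθ_k)_k ⊂ ℂ`, indexed by
   `Option (Fin s ⊕ Fin s')`, is linearly independent over `ℚ̄ = algebraicClosure ℚ ℂ`.
3. `eq_zero_of_linearIndependent_option_sum_elim` — pure finite-dimensional linear algebra: against
   such a certificate one finite relation `a • u + Σᵢ cᵢ • vᵢ + Σ_k c'_k • v'_k = 0` has all
   coefficients zero (`Fintype.linearIndependent_iff`, the sum split by `Fintype.sum_option` and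
   `Fintype.sum_sum_type`).
4. The registered statement: multiply the real relation by `i` and read it in `ℂ` with the
   coefficients `r i, Cᵢ i, D_k ∈ ℚ̄` (`i ∈ ℚ̄`) against the vectors `1, log εᵢ, iθ_k`; apply 3 to 2.

Sources: A. Baker, *Transcendental Number Theory* (1975), Theorem 2.1; M. Kontsevich, D. Zagier,
*Periods* (2001), §1.2 (the role of such relations among logarithms and arguments of algebraic
numbers in Conjecture 1 for one-dimensional representations).
-/

noncomputable section

open Complex

namespace Summit.KontsevichZagierPeriods.HurwitzMicroSectors.NormalFormPrinciple.PiBox.Dlog.AngSiegeK8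

/-! ## The finite core -/

/-- **Finite core.** If the finite family `u, (vᵢ)ᵢ, (v'_k)_k` (indexed by `Option (ι ⊕ ι')`,
`none ↦ u`, `some (inl i) ↦ vᵢ`, `some (inr k) ↦ v'_k`) is linearly independent over `K`, then a
relation `a • u + Σᵢ cᵢ • vᵢ + Σ_k c'_k • v'_k = 0` with coefficients in `K` has `a = 0`, every
`cᵢ = 0` and every `c'_k = 0`. [folklore] -/
theorem eq_zero_of_linearIndependent_option_sum_elim {K V ι ι' : Type*} [Ring K] [AddCommGroup V]
    [Module K V] [Fintype ι] [Fintype ι'] {u : V} {v : ι → V} {v' : ι' → V}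
    (hli : LinearIndependent K fun o : Option (ι ⊕ ι') => o.elim u (Sum.elim v v'))
    (a : K) (c : ι → K) (c' : ι' → K)
    (h : a • u + ∑ i, c i • v i + ∑ k, c' k • v' k = 0) :
    a = 0 ∧ (∀ i, c i = 0) ∧ ∀ k, c' k = 0 := by
  have h0 : ∀ o, Option.elim o a (Sum.elim c c') = 0 :=
    Fintype.linearIndependent_iff.mp hli (fun o => o.elim a (Sum.elim c c')) (by
      rw [Fintype.sum_option, Fintype.sum_sum_type]
      simpa only [Option.elim_none, Option.elim_some, Sum.elim_inl, Sum.elim_inr, add_assoc]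
        using h)
  exact ⟨h0 none, fun i => h0 (some (Sum.inl i)), fun k => h0 (some (Sum.inr k))⟩

/-! ## The certificate -/

/-- **The `ℚ`-relations separate into real and imaginary parts.** If `log ε₁, …, log ε_s` are
`ℚ`-linearly independent reals and `θ₁, …, θ_{s'}` are `ℚ`-linearly independent reals, then the
mixed family of complex numbers `log ε₁, …, log ε_s, iθ₁, …, iθ_{s'}` (indexed by `Fin s ⊕ Fin s'`)
is `ℚ`-linearly independent: its image under `z ↦ (re z, im z)` is
`(log εᵢ, 0)ᵢ, (0, θ_k)_k`. [folklore] -/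
theorem linearIndependent_rat_logs_angles {s s' : ℕ} (ε : Fin s → ℝ)
    (hli : LinearIndependent ℚ (fun i => Real.log (ε i))) (θ : Fin s' → ℝ)
    (hliθ : LinearIndependent ℚ θ) :
    LinearIndependent ℚ
      (Sum.elim (fun i => ((Real.log (ε i) : ℝ) : ℂ)) (fun k => (θ k : ℂ) * I)) := by
  refine LinearIndependent.of_comp
    ((Complex.reLm.restrictScalars ℚ).prod (Complex.imLm.restrictScalars ℚ)) ?_
  have hcomp : ⇑((Complex.reLm.restrictScalars ℚ).prod (Complex.imLm.restrictScalars ℚ)) ∘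
      Sum.elim (fun i => ((Real.log (ε i) : ℝ) : ℂ)) (fun k => (θ k : ℂ) * I) =
      Sum.elim (LinearMap.inl ℚ ℝ ℝ ∘ fun i => Real.log (ε i)) (LinearMap.inr ℚ ℝ ℝ ∘ θ) := by
    funext o
    rcases o with i | k
    · simp
    · simp
  rw [hcomp]
  exact linearIndependent_inl_union_inr' hli hliθ

/-- **Baker's certificate for real logarithms and arguments of algebraic numbers.** For positive
real algebraic `ε₁, …, ε_s` with `ℚ`-linearly independent logarithms and `ℚ`-linearly independent
reals `θ₁, …, θ_{s'}` with every `e^{iθ_k}` algebraic, the finite family of complex numbers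
`1, log ε₁, …, log ε_s, iθ₁, …, iθ_{s'}` is linearly independent over the field
`ℚ̄ = algebraicClosure ℚ ℂ` of all algebraic numbers (Baker's Theorem 2.1 with the logarithms
`lᵢ = log εᵢ`, `e^{lᵢ} = εᵢ`, and `l_k = iθ_k`). [cite: Baker1975, Theorem 2.1] -/
theorem linearIndependent_algebraicClosure_one_logs_angles {s s' : ℕ} (ε : Fin s → ℝ)
    (hε : ∀ i, 0 < ε i) (hεalg : ∀ i, IsAlgebraic ℚ (ε i))
    (hli : LinearIndependent ℚ (fun i => Real.log (ε i))) (θ : Fin s' → ℝ)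
    (hθalg : ∀ k, IsAlgebraic ℚ (Complex.exp ((θ k : ℂ) * I))) (hliθ : LinearIndependent ℚ θ) :
    LinearIndependent (algebraicClosure ℚ ℂ) fun o : Option (Fin s ⊕ Fin s') =>
      o.elim (1 : ℂ) (Sum.elim (fun i => ((Real.log (ε i) : ℝ) : ℂ)) (fun k => (θ k : ℂ) * I)) := by
  refine Literature.NumberTheory.Transcendental.baker_holds _ (fun o => ?_)
    (linearIndependent_rat_logs_angles ε hli θ hliθ)
  rcases o with i | k
  · -- `e^{log εᵢ} = εᵢ` is algebraic
    rw [Sum.elim_inl, ← Complex.ofReal_exp, Real.exp_log (hε i)]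
    exact (hεalg i).algebraMap
  · -- `e^{iθ_k}` is algebraic by hypothesis
    rw [Sum.elim_inr]
    exact hθalg k

/-! ## The registered sub-goal -/

/-- **Mixed Baker endgame** (registered sub-goal `eq_zero_of_alg_logs_angles_eq_zero` of crux
stmt-KontsevichZagierPeriods-3869, arctangent layer of the leaf `stub_boxRigidity`). If
`ε₁, …, ε_s > 0` are real algebraic with `ℚ`-linearly independent logarithms, `θ₁, …, θ_{s'}` are
`ℚ`-linearly independent reals with every `e^{iθ_k}` algebraic, and
`r + Σᵢ Cᵢ log εᵢ + Σ_k D_k θ_k = 0` with real ALGEBRAIC `r, Cᵢ, D_k`, then `r = 0`, every `Cᵢ = 0`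
and every `D_k = 0`: the relation multiplied by `i`, read in `ℂ` with its coefficients
`r i, Cᵢ i, D_k ∈ ℚ̄` against the vectors `1, log εᵢ, iθ_k`, is a finite relation against Baker's
certificate (`linearIndependent_algebraicClosure_one_logs_angles`), so the finite core
(`eq_zero_of_linearIndependent_option_sum_elim`) kills every coefficient.
[cite: Baker1975, Theorem 2.1] -/
theorem eq_zero_of_alg_logs_angles_eq_zero {s s' : ℕ} (ε : Fin s → ℝ) (hε : ∀ i, 0 < ε i)
    (hεalg : ∀ i, IsAlgebraic ℚ (ε i)) (hli : LinearIndependent ℚ (fun i => Real.log (ε i)))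
    (θ : Fin s' → ℝ) (hθalg : ∀ k, IsAlgebraic ℚ (Complex.exp ((θ k : ℂ) * I)))
    (hliθ : LinearIndependent ℚ θ) (r : ℝ) (hr : IsAlgebraic ℚ r) (C : Fin s → ℝ)
    (hC : ∀ i, IsAlgebraic ℚ (C i)) (D : Fin s' → ℝ) (hD : ∀ k, IsAlgebraic ℚ (D k))
    (h : r + ∑ i, C i * Real.log (ε i) + ∑ k, D k * θ k = 0) :
    r = 0 ∧ (∀ i, C i = 0) ∧ ∀ k, D k = 0 := by
  -- real algebraic numbers, complexified, are elements of `ℚ̄ ⊂ ℂ`; so is `i`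
  have hmem : ∀ x : ℝ, IsAlgebraic ℚ x → (x : ℂ) ∈ algebraicClosure ℚ ℂ := fun x hx =>
    mem_algebraicClosure_iff.mpr hx.algebraMap
  have hI : I ∈ algebraicClosure ℚ ℂ :=
    mem_algebraicClosure_iff.mpr Complex.isIntegral_rat_I.isAlgebraic
  -- the relation multiplied by `i`, read in `ℂ`
  have hrel : (r : ℂ) * I * (1 : ℂ) + ∑ i, (C i : ℂ) * I * ((Real.log (ε i) : ℝ) : ℂ)
      + ∑ k, (D k : ℂ) * ((θ k : ℂ) * I) = 0 := by
    have h1 : ((r + ∑ i, C i * Real.log (ε i) + ∑ k, D k * θ k : ℝ) : ℂ) * I = 0 := by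
      rw [h, Complex.ofReal_zero, zero_mul]
    rw [← h1]
    simp only [Complex.ofReal_add, Complex.ofReal_sum, Complex.ofReal_mul, add_mul,
      Finset.sum_mul, mul_one, mul_assoc, mul_comm I]
  -- decide on the finite core against Baker's certificate
  obtain ⟨hr0, hC0, hD0⟩ := eq_zero_of_linearIndependent_option_sum_elim
    (linearIndependent_algebraicClosure_one_logs_angles ε hε hεalg hli θ hθalg hliθ)
    (⟨(r : ℂ) * I, mul_mem (hmem r hr) hI⟩ : algebraicClosure ℚ ℂ)
    (fun i => ⟨(C i : ℂ) * I, mul_mem (hmem (C i) (hC i)) hI⟩)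
    (fun k => ⟨(D k : ℂ), hmem (D k) (hD k)⟩) hrel
  refine ⟨?_, fun i => ?_, fun k => ?_⟩
  · have h1 : (r : ℂ) * I = 0 := congrArg Subtype.val hr0
    exact Complex.ofReal_eq_zero.mp ((mul_eq_zero.mp h1).resolve_right Complex.I_ne_zero)
  · have h1 : (C i : ℂ) * I = 0 := congrArg Subtype.val (hC0 i)
    exact Complex.ofReal_eq_zero.mp ((mul_eq_zero.mp h1).resolve_right Complex.I_ne_zero)
  · exact Complex.ofReal_eq_zero.mp (congrArg Subtype.val (hD0 k))

end Summit.KontsevichZagierPeriods.HurwitzMicroSectors.NormalFormPrinciple.PiBox.Dlog.AngSiegeK8
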